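import Literature.Probability.Percolation.CorrelationLengthDKTSupercritical
import Summits.CriticalPhenomena.PercolationContinuityZ3.Theorems.PercNearOneGluingNoHeavyQuantOneArmOfSupercritical
import Summits.CriticalPhenomena.PercolationContinuityZ3.Theorems.PercNearOneGluingNoHeavyQuantExponentCeilings
import HarnessLib

/-!
# PAPER-2 track, ARM-3 gen 3: the UNCONDITIONAL transfer (T2) ⇒ (T1) — every modulus of continuity of `θ` at `p_c⁺` is a
# one-arm rate at `p_c`, at the scale `p − p_c = √(2C_d/log n)`, by the quantitative Grimmett–Marstrand theorem of
# Duminil-Copin–Kozma–Tassion; a Hölder modulus gives a POLYLOGARITHMIC one-arm rate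

builds on p205010 (kernel theorem, internal audit signed; external expert review pending).
Status sentence for p205010: "θ(p_c) = 0 on ℤ^d, all d ≥ 2 — kernel-verified (Lean 4/Mathlib, standard
axioms); internal adversarial audit SIGNED 2026-08-20 04:29Z; external expert review pending."

Seat `prim-quant-arm-3` (gen 3), `--supports stmt-CriticalPhenomena-4575`; pure proofs, no definitions.  Notation:
`P_p = bondPercolation (zdGraph d) p`, `p_c = criticalProbI d`, `π_p(n) = oneArmProb d p n`, `θ(p) = theta (zdGraph d) 0 p`,
`π^f_p(n) = P_p(0 ↔ ∂Λ_n, 0 ↮ ∞)`, `κ_d = |HOct d| = 2^d d!` (signed coordinate permutations).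

The lane's R4 gives (T1) ⇒ (T2): any one-arm RATE at `p_c` yields an explicit MODULUS for `θ` at `p_c⁺` (Theorem A,
`Quant.thetaModulus_of_oneArmRate…`; for power laws, exponent `2c/(d−c)`, `…QuantHyperscalingTransfers`).  This file proves
the CONVERSE, unconditionally, for every `d ≥ 3`:

* `Quant.truncatedArm_le_exp_dkt` — **Duminil-Copin–Kozma–Tassion's Theorem 2 (`p > p_c`) in UNIFORM form**: there is
  `C = C(d) > 0` with `π^f_p(n) ≤ κ_d · exp(−n · e^{−C/(p−p_c)²})` for ALL `p ∈ (p_c, 1)` and ALL `n` (the tree's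
  `DuminilcopinKozmaTassion2020_thm2_supercritical_holds` states the `liminf` rate; the uniform form re-runs its §6 assembly and ends with
  the renewal bound `DKT20.real_truncatedArm_le`, which holds at every `n`, and `(1−x)^j ≤ e^{−xj}`);
* `Quant.oneArm_criticalProbI_le_theta_add_exp` — `π_{p_c}(n) ≤ θ(p_c + δ) + κ_d exp(−n e^{−C/δ²})` for every `0 < δ < 1 − p_c`
  and every `n` (monotonicity `π_{p_c} ≤ π_p` and `π_p ≤ θ(p) + π^f_p`, part 1 of route (E));
* **`Quant.oneArm_criticalProbI_le_theta_sqrt_log`** — at `δ_n = √(2C/log n)`: `π_{p_c}(n) ≤ θ(p_c + √(2C/log n)) + κ_d e^{−√n}`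
  for all `n` with `√(2C/log n) < 1 − p_c`: EVERY modulus of `θ` at `p_c⁺` is a one-arm rate at `p_c`;
* **`Quant.oneArm_le_rpow_log_of_thetaHolder`** — `ThetaHolderNearCritical d b B` (`b > 0`) ⟹ `π_{p_c}(n) ≤ A (log n)^{−b/2}` for all
  `n ≥ 2`, some `A`: a Hölder modulus for `θ` (the lane's (T2)) would by itself give a POLYLOGARITHMIC one-arm rate — the regime that
  the effective Kozma–Nitzan scheme provably cannot reach (R6, iterated logarithm) and for which the lane has typed the open
  inputs (J)/(N); so (T2) with a power is at least as hard as the polylog intermediate of (T1).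

With `…QuantHyperscalingTransfers` this sandwiches (T2) between the two forms of (T1), unconditionally:
`PolyArm_d(c) ⟹ Hold_d(2c/(d−c)) ⟹ π_{p_c}(n) ≤ A (log n)^{−c/(d−c)}`.  Nothing here is a rate: `θ` has no known Hölder modulus for
`3 ≤ d ≤ 10` (the tree's explicit modulus is of iterated-logarithm type, and transfers to nothing new).  The constant `C = C(d)` is
DKT's (existential in the tree: it contains the constant of their Theorem 7).  Memo: POWERLAW-SURVEY.md §11 (gen 3).

## References
* H. Duminil-Copin, G. Kozma, V. Tassion, *Upper bounds on the percolation correlation length*, in: *In and Out of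
  Equilibrium 3*, Progr. Probab. 77 (2020), arXiv:1902.03207: Theorem 2 and §6 [DuminilcopinKozmaTassion2020].
* J. T. Chayes, L. Chayes, C. M. Newman, Ann. Probab. 15 (1987) 1272–1287 (the renewal bound `ξ_p ≤ n/θ(p,n)`) [ChayesChayesNewman1987].
* G. R. Grimmett, J. M. Marstrand, Proc. R. Soc. Lond. A 430 (1990) 439–457 [GrimmettMarstrand1990].
-/

noncomputable section

namespace Summit.CriticalPhenomena.PercolationContinuityZ3.Theorems.Quant

open MeasureTheory Filter Topology Literature.Probability.Percolation Literature.Probability.LatticeModels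
open Literature.Probability.Percolation.DKT20
open scoped ENNReal

variable {d : ℕ}

/-! ### §1. DKT Theorem 2 (supercritical) in uniform form -/

/-- **DKT's rate bound, pointwise in `p`** (the content of the tree's assembly of Theorem 2, `p > p_c`, before the `liminf`):
for `d ≥ 3` there is `C = C(d) > 0` such that for every `p ∈ (p_c, 1)` there is a slab thickness `T` with
`exp(−C/(p − p_c)²) ≤ p · θ_bot(p, T)/(T + 2)`.  Steps 1–3 and 5 of `DuminilcopinKozmaTassion2020_thm2_supercritical_holds`, verbatim.
[cite: DuminilcopinKozmaTassion2020, Theorem 2 and §6 (proof)] -/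
theorem dkt_exp_le_thetaBot_div (hd : 3 ≤ d) :
    haveI : NeZero d := ⟨by omega⟩
    ∃ C : ℝ, 0 < C ∧ ∀ p : unitInterval, criticalProb (zdGraph d) (0 : Site d) < (p : ℝ) → (p : ℝ) < 1 →
      ∃ T : ℕ, Real.exp (-(C / ((p : ℝ) - criticalProb (zdGraph d) (0 : Site d)) ^ 2)) ≤
        (p : ℝ) * thetaBot d p T / (T + 2) := by
  classical
  haveI : NeZero d := ⟨by omega⟩
  have hd1 : 1 ≤ d := by omega
  have hd0 : (0 : ℝ) < d := by exact_mod_cast (show 0 < d by omega)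
  set pc : ℝ := criticalProb (zdGraph d) (0 : Site d) with hpcdef
  have hpc0 : 0 < pc := criticalProb_zd_pos d hd1
  have hpc1 : pc ≤ 1 := (criticalProb_mem_Icc (zdGraph d) (0 : Site d)).2
  have hpc64 : pc ≤ 63 / 64 := criticalProb_zd_le (d := d) (by omega)
  obtain ⟨C₀, hC₀, n₀, hthr⟩ := slab_threshold_bound (d := d) hd
  -- the constants (depending on `d` only)
  set C₁ : ℝ := 16 * C₀ ^ 2 + Real.log (n₀ + 4) with hC₁
  have hlog0 : 0 ≤ Real.log ((n₀ : ℝ) + 4) := Real.log_nonneg (by linarith [(Nat.cast_nonneg n₀ : (0 : ℝ) ≤ n₀)])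
  have hC₁0 : 0 ≤ C₁ := by positivity
  set K : ℝ := pc ^ 2 / (8 * d * 10 ^ (d + 1)) with hK
  have hK0 : 0 < K := by positivity
  have hd1r : (1 : ℝ) ≤ d := by exact_mod_cast hd1
  have hK1 : K ≤ 1 := by rw [hK]; exact K_le_one hd1r hpc0 hpc1
  set C : ℝ := ((d + 1 : ℕ) : ℝ) * C₁ + 1 - Real.log K + 1 with hC
  have hLK : 0 ≤ -Real.log K := by rw [neg_nonneg]; exact Real.log_nonpos hK0.le hK1
  have hCpos : 0 < C := by
    have : 0 ≤ ((d + 1 : ℕ) : ℝ) * C₁ := by positivity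
    linarith
  refine ⟨C, hCpos, fun p hpcp hp1 => ?_⟩
  -- the parameter gap
  set δ : ℝ := (p : ℝ) - pc with hδ
  have hδ0 : 0 < δ := by rw [hδ]; linarith
  have hδ1 : δ ≤ 1 := by rw [hδ]; linarith [p.2.2]
  have hp0 : 0 < (p : ℝ) := hpc0.trans hpcp
  -- the scale
  obtain ⟨N, hNn₀, hN2, hNC₀, hNle⟩ := exists_scale C₀ hC₀ n₀ hδ0 hδ1
  have hN1 : 1 ≤ N := by omega
  have hNreal1 : (1 : ℝ) ≤ N := by exact_mod_cast hN1
  -- the starting density `p' = pc + δ'`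
  set δ' : ℝ := min (δ / 4) (1 / 256) with hδ'
  have hδ'0 : 0 < δ' := lt_min (by linarith) (by norm_num)
  have hδ'δ : δ' ≤ δ / 4 := min_le_left _ _
  have hδ'1 : δ' ≤ 1 / 256 := min_le_right _ _
  have hp'01 : pc + δ' ∈ unitInterval := ⟨by linarith, by linarith⟩
  set p' : unitInterval := ⟨pc + δ', hp'01⟩ with hp'
  have hp'pc : criticalProb (zdGraph d) 0 < (p' : ℝ) := by show pc < pc + δ'; linarith
  have hp'lt1 : (p' : ℝ) < 1 := by show pc + δ' < 1; linarith
  have hp'78 : (p' : ℝ) ≤ 127 / 128 := by show pc + δ' ≤ 127 / 128; linarith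
  have hp'0 : 0 < (p' : ℝ) := by show 0 < pc + δ'; linarith
  have hφ : ∀ S ∈ DCT16.originSets d N, Real.exp (-1) ≤ DCT16.phi p' S := fun S hS =>
    ((Real.exp_le_exp.2 (by norm_num : (-1 : ℝ) ≤ 0)).trans_eq Real.exp_zero).trans
      (one_le_phi p' hp'pc hp'lt1 (DCT16.mem_originSets.1 hS).2)
  -- step 1: the slab percolates strictly below `p`
  have hslab := hthr N hNn₀ p' hp'0 hp'78 hφ
  have hq01 : (p : ℝ) - δ / 4 ∈ unitInterval := ⟨by linarith, by linarith [p.2.2]⟩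
  set q : unitInterval := ⟨(p : ℝ) - δ / 4, hq01⟩ with hq
  have hqlt : criticalProb ((zdGraph d).induce (dktSlab d N)) ⟨0, zero_mem_dktSlab d N⟩ < q := by
    show criticalProb ((zdGraph d).induce (dktSlab d N)) ⟨0, zero_mem_dktSlab d N⟩ < (p : ℝ) - δ / 4
    calc criticalProb ((zdGraph d).induce (dktSlab d N)) ⟨0, zero_mem_dktSlab d N⟩ ≤ p' + C₀ / Real.sqrt (Real.log N) := hslab
      _ = pc + δ' + C₀ / Real.sqrt (Real.log N) := rfl
      _ ≤ pc + δ / 4 + δ / 4 := by linarith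
      _ < (p : ℝ) - δ / 4 := by rw [hδ]; linarith
  have hqp : (q : ℝ) < p := by show (p : ℝ) - δ / 4 < p; linarith
  -- step 2: a density `≥ δ/4` inside the slab
  obtain ⟨u, hu, hη⟩ := exists_rep_real_percolatesVia_ge (d := d) N hqlt hqp hp1
  have hη' : δ / 4 ≤ (bondPercolation (zdGraph d) p).real (percolatesVia (withinGraph (zdGraph d) (dktSlab d N)) u) := by
    refine le_trans ?_ hη
    show δ / 4 ≤ ((p : ℝ) - ((p : ℝ) - δ / 4)) / ((p : ℝ) * (1 - ((p : ℝ) - δ / 4)))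
    exact gap_le_meanField hp0 p.2.2 hδ0 (by linarith)
  -- step 3: the slab density from the boundary
  have hT : dktSlab d N ⊆ {x : Site d | |x 0| ≤ 2 * N} := fun x hx => hx 0 (by simp) (by simp)
  have hbot := thetaBot_ge hN1 p hpcp hp1 hT (mem_dktSlab_of_mem_slabReps hu)
  set θ : ℝ := thetaBot d p (8 * N) with hθ
  have ha0 : 0 ≤ (p : ℝ) / (2 * d * (2 * (4 * (N : ℝ)) + 1) ^ d) := by positivity
  have hθge : (p : ℝ) / (2 * d * (2 * (4 * (N : ℝ)) + 1) ^ d) * (δ / 4) ≤ θ :=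
    (mul_le_mul_of_nonneg_left hη' ha0).trans hbot
  refine ⟨8 * N, ?_⟩
  rw [← hθ]
  push_cast
  -- step 5: arithmetic
  have hmid : K * δ / (N : ℝ) ^ (d + 1) ≤ (p : ℝ) * θ / (8 * N + 2) :=
    mid_arith hd1r hNreal1 hpc0 hpcp.le hδ0 hK hθge
  have hC' : ((d + 1 : ℕ) : ℝ) * C₁ + 1 - Real.log K + 1 ≤ C := le_rfl
  have hmain := exp_le_mul_div_pow (e := d + 1) hK0 hK1 hδ0 hδ1 hN1 (by rw [hC₁]; exact hNle) hC'
  exact hmain.trans hmid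

/-- **Duminil-Copin–Kozma–Tassion 2020, Theorem 2 (`p > p_c`), UNIFORM form.**  For `d ≥ 3` there is `C = C(d) > 0` such that for
every `p ∈ (p_c, 1)` and EVERY `n`,
`P_p(0 ↔ ∂Λ_n, 0 ↮ ∞) ≤ |HOct d| · exp(−n · exp(−C/(p − p_c)²))`.
Proof: `dkt_exp_le_thetaBot_div` (DKT §6: slab threshold at scale `N ≤ exp(C₁/δ²)`, density `≥ δ/4` in the slab, boundary density
`θ_bot(p, 8N) ≥ pδ/(8d(8N+1)^d)`, arithmetic `exp(−C/δ²) ≤ pθ_bot/(8N+2)`), then the renewal bound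
`P_p(0 ↔ ∂Λ_n, 0 ↮ ∞) ≤ |HOct d| (1 − pθ_bot)^{⌊n/(T+2)⌋+1}` (`real_truncatedArm_le`, valid at EVERY `n`) with `(1−x)^j ≤ e^{−xj}` and
`⌊n/(T+2)⌋ + 1 ≥ n/(T+2)` instead of its `liminf`.  Same constant `C` as the tree's Theorem 2.
[cite: DuminilcopinKozmaTassion2020, Theorem 2 and §6 (proof; ξ_p ≤ n/θ(p,n) from [CCN87])] -/
theorem truncatedArm_le_exp_dkt (hd : 3 ≤ d) :
    ∃ C : ℝ, 0 < C ∧ ∀ p : unitInterval, (criticalProbI d : ℝ) < p → (p : ℝ) < 1 → ∀ n : ℕ,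
      (bondPercolation (zdGraph d) p).real (siteToBoundary d n ∩ (percolatesAt (0 : Site d))ᶜ) ≤
        Fintype.card (GM.HOct d) * Real.exp (-((n : ℝ) * Real.exp (-(C / ((p : ℝ) - criticalProbI d) ^ 2)))) := by
  classical
  haveI : NeZero d := ⟨by omega⟩
  obtain ⟨C, hC, h⟩ := dkt_exp_le_thetaBot_div hd
  refine ⟨C, hC, fun p hpcp hp1 n => ?_⟩
  have hpcI : (criticalProbI d : ℝ) = criticalProb (zdGraph d) (0 : Site d) := coe_criticalProbI d
  rw [hpcI] at hpcp ⊢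
  obtain ⟨T, hrate⟩ := h p hpcp hp1
  set E : ℝ := Real.exp (-(C / ((p : ℝ) - criticalProb (zdGraph d) (0 : Site d)) ^ 2)) with hE
  set θ : ℝ := thetaBot d p T with hθ
  have hθ01 : θ ∈ Set.Icc (0 : ℝ) 1 := thetaBot_mem_Icc (d := d) p T
  -- the renewal bound at EVERY `n`
  have hren := real_truncatedArm_le (d := d) p n T
  rw [← hθ] at hren
  set κ : ℝ := (Fintype.card (GM.HOct d) : ℝ) with hκ
  have hκ0 : 0 ≤ κ := by rw [hκ]; exact Nat.cast_nonneg _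
  have hpθ0 : 0 ≤ (p : ℝ) * θ := mul_nonneg p.2.1 hθ01.1
  have hpθ1 : (p : ℝ) * θ ≤ 1 := by
    calc (p : ℝ) * θ ≤ 1 * 1 := mul_le_mul p.2.2 hθ01.2 hθ01.1 zero_le_one
      _ = 1 := one_mul 1
  set j : ℕ := n / (T + 2) + 1 with hj
  have hT0 : (0 : ℝ) < T + 2 := by positivity
  have hjge : (n : ℝ) / (T + 2) ≤ j := by
    rw [div_le_iff₀ hT0, hj]
    have h1 : (T + 2) * (n / (T + 2)) ≤ n := Nat.mul_div_le n (T + 2)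
    have h2 : n < (T + 2) * (n / (T + 2) + 1) := by
      have := Nat.lt_mul_div_succ n (show 0 < T + 2 by omega)
      linarith
    have h3 : (n : ℝ) < ((T + 2 : ℕ) : ℝ) * ((n / (T + 2) + 1 : ℕ) : ℝ) := by exact_mod_cast h2
    push_cast at h3 ⊢
    linarith
  have hexp1 : (1 - (p : ℝ) * θ) ^ j ≤ Real.exp (-((p : ℝ) * θ * j)) := by
    -- `(1 − x)^j ≤ (e^{−x})^j = e^{−xj}` (cf. `Literature.Computability.MetaComplexity.one_sub_pow_le_exp`)
    have h1 : 1 - (p : ℝ) * θ ≤ Real.exp (-((p : ℝ) * θ)) := by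
      have := Real.add_one_le_exp (-((p : ℝ) * θ))
      linarith
    calc (1 - (p : ℝ) * θ) ^ j ≤ Real.exp (-((p : ℝ) * θ)) ^ j := pow_le_pow_left₀ (by linarith) h1 j
      _ = Real.exp (-((p : ℝ) * θ * j)) := by rw [← Real.exp_nat_mul]; ring_nf
  have hexp2 : Real.exp (-((p : ℝ) * θ * j)) ≤ Real.exp (-((n : ℝ) * E)) := by
    apply Real.exp_le_exp.2
    have hn0 : (0 : ℝ) ≤ n := Nat.cast_nonneg n
    have h1 : (n : ℝ) * E ≤ (n : ℝ) * ((p : ℝ) * θ / (T + 2)) := mul_le_mul_of_nonneg_left hrate hn0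
    have h2 : (n : ℝ) * ((p : ℝ) * θ / (T + 2)) = (p : ℝ) * θ * ((n : ℝ) / (T + 2)) := by ring
    have h3 : (p : ℝ) * θ * ((n : ℝ) / (T + 2)) ≤ (p : ℝ) * θ * j := mul_le_mul_of_nonneg_left hjge hpθ0
    linarith
  calc (bondPercolation (zdGraph d) p).real (siteToBoundary d n ∩ (percolatesAt (0 : Site d))ᶜ)
      ≤ κ * (1 - (p : ℝ) * θ) ^ (n / (T + 2) + 1) := hren
    _ ≤ κ * Real.exp (-((p : ℝ) * θ * j)) := mul_le_mul_of_nonneg_left hexp1 hκ0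
    _ ≤ κ * Real.exp (-((n : ℝ) * E)) := mul_le_mul_of_nonneg_left hexp2 hκ0

/-! ### §2. The transfer: `π_{p_c}(n) ≤ θ(p_c + δ) + κ_d exp(−n e^{−C/δ²})` -/

/-- **The supercritical comparison at `p_c`, unconditional form**: for `d ≥ 3` there is `C = C(d) > 0` (DKT's constant) such
that for every `p ∈ (p_c, 1)` and every `n`, writing `δ = p − p_c`,
`π_{p_c}(n) ≤ θ(p) + |HOct d| · exp(−n · e^{−C/δ²})`
(`π_{p_c}(n) ≤ π_p(n) ≤ θ(p) + P_p(0 ↔ ∂Λ_n, 0 ↮ ∞)` and §1).  New as stated; mechanism DKT 2020 Thm. 2.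
builds on p205010 (kernel theorem, internal audit signed; external expert review pending) (not used).
[cite: DuminilcopinKozmaTassion2020, Theorem 2 (p > p_c)] -/
theorem oneArm_criticalProbI_le_theta_add_exp (hd : 3 ≤ d) :
    ∃ C : ℝ, 0 < C ∧ ∀ p : unitInterval, (criticalProbI d : ℝ) < p → (p : ℝ) < 1 → ∀ n : ℕ,
      oneArmProb d (criticalProbI d) n ≤
        theta (zdGraph d) 0 p +
          Fintype.card (GM.HOct d) * Real.exp (-((n : ℝ) * Real.exp (-(C / ((p : ℝ) - criticalProbI d) ^ 2)))) := by
  obtain ⟨C, hC, h⟩ := truncatedArm_le_exp_dkt hd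
  refine ⟨C, hC, fun p hp0 hp1 n => ?_⟩
  have hpge : criticalProbI d ≤ p := (Subtype.coe_lt_coe.1 hp0).le
  calc oneArmProb d (criticalProbI d) n ≤ oneArmProb d p n := oneArmProb_criticalProbI_le_of_le hpge n
    _ ≤ theta (zdGraph d) 0 p + (bondPercolation (zdGraph d) p).real (siteToBoundary d n ∩ (percolatesAt (0 : Site d))ᶜ) :=
        oneArmProb_le_theta_add_truncated p n
    _ ≤ theta (zdGraph d) 0 p + Fintype.card (GM.HOct d) * Real.exp (-((n : ℝ) * Real.exp (-(C / ((p : ℝ) - criticalProbI d) ^ 2)))) :=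
        add_le_add le_rfl (h p hp0 hp1 n)

/-- At `δ = √(2C/log n)`: `n · e^{−C/δ²} = n · e^{−(log n)/2} = √n`. [folklore] -/
theorem mul_exp_neg_div_sqrtLog_sq {C : ℝ} (hC : 0 < C) {n : ℕ} (hn : 2 ≤ n) :
    (n : ℝ) * Real.exp (-(C / Real.sqrt (2 * C / Real.log n) ^ 2)) = Real.sqrt n := by
  have hn0 : (0 : ℝ) < n := by exact_mod_cast (show 0 < n by omega)
  have hlog : 0 < Real.log n := Real.log_pos (by exact_mod_cast (show 1 < n by omega))
  have hx : 0 ≤ 2 * C / Real.log n := by positivity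
  rw [Real.sq_sqrt hx]
  have h1 : C / (2 * C / Real.log n) = Real.log n / 2 := by field_simp
  have h2 : Real.sqrt n = Real.exp (Real.log n / 2) := by
    rw [Real.sqrt_eq_rpow, Real.rpow_def_of_pos hn0]; ring_nf
  rw [h1, h2]
  calc (n : ℝ) * Real.exp (-(Real.log n / 2)) = Real.exp (Real.log n) * Real.exp (-(Real.log n / 2)) := by
        rw [Real.exp_log hn0]
    _ = Real.exp (Real.log n / 2) := by rw [← Real.exp_add]; ring_nf

/-- **EVERY modulus of `θ` at `p_c⁺` is a one-arm rate at `p_c`** (`d ≥ 3`, unconditional): with DKT's constant `C = C(d) > 0`, for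
every `n ≥ 2` and the parameter `p = p_c + √(2C/log n)` (when `< 1`),
`π_{p_c}(n) ≤ θ(p_c + √(2C/log n)) + |HOct d| · e^{−√n}`.
The converse direction of the lane's Theorem A (rate ⇒ modulus); together they make an explicit one-arm rate at `p_c` and an explicit
modulus of continuity of `θ` at `p_c⁺` EQUIVALENT data in every `d ≥ 3`, with the distortions `n ↦ p_c + √(2C/log n)` (here) and
`p ↦ n(p)` of Theorem A.  New; mechanism DKT 2020 Thm. 2 (quantitative Grimmett–Marstrand).
builds on p205010 (kernel theorem, internal audit signed; external expert review pending) (not used).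
[cite: DuminilcopinKozmaTassion2020, Theorem 2 (p > p_c)] -/
theorem oneArm_criticalProbI_le_theta_sqrt_log (hd : 3 ≤ d) :
    ∃ C : ℝ, 0 < C ∧ ∀ n : ℕ, 2 ≤ n → ∀ p : unitInterval,
      (p : ℝ) = criticalProbI d + Real.sqrt (2 * C / Real.log n) → (p : ℝ) < 1 →
      oneArmProb d (criticalProbI d) n ≤ theta (zdGraph d) 0 p + Fintype.card (GM.HOct d) * Real.exp (-Real.sqrt n) := by
  obtain ⟨C, hC, h⟩ := oneArm_criticalProbI_le_theta_add_exp hd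
  refine ⟨C, hC, fun n hn p hp hp1 => ?_⟩
  have hlog : 0 < Real.log n := Real.log_pos (by exact_mod_cast (show 1 < n by omega))
  have hδ0 : 0 < Real.sqrt (2 * C / Real.log n) := Real.sqrt_pos.2 (by positivity)
  have h1 := h p (by rw [hp]; linarith) hp1 n
  rwa [show (p : ℝ) - criticalProbI d = Real.sqrt (2 * C / Real.log n) by rw [hp]; ring,
    mul_exp_neg_div_sqrtLog_sq hC hn] at h1

/-! ### §3. A Hölder modulus gives a polylogarithmic one-arm rate -/

/-- `e^{−√x} ≤ 2/x` for `x > 0` (from `e^{y} ≥ 1 + y + y²/2 ≥ y²/2`). [folklore] -/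
theorem exp_neg_sqrt_le_two_div {x : ℝ} (hx : 0 < x) : Real.exp (-Real.sqrt x) ≤ 2 / x := by
  have hs : 0 ≤ Real.sqrt x := Real.sqrt_nonneg x
  have hq : Real.sqrt x ^ 2 / 2 ≤ Real.exp (Real.sqrt x) := by
    have h := Real.quadratic_le_exp_of_nonneg hs
    nlinarith
  rw [Real.sq_sqrt hx.le] at hq
  rw [Real.exp_neg, inv_le_comm₀ (Real.exp_pos _) (by positivity)]
  rw [inv_div]
  exact hq

/-- **(T2) with a power ⇒ (T1) with an inverse power of `log`** (`d ≥ 3`, unconditional implication): if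
`ThetaHolderNearCritical d b B` with `b > 0`, then there is `A` with **`π_{p_c}(n) ≤ A · (log n)^{−b/2}` for all `n ≥ 2`**.
Proof: §2 at `δ_n = √(2C/log n)` gives `π_{p_c}(n) ≤ B (2C)^{b/2} (log n)^{−b/2} + |HOct d| e^{−√n}` for large `n`, and `e^{−√n} ≤ 2/n ≤
2 (log n)^{−b/2}` as `b ≤ 1 ≤ 2` (`thetaHolderNearCritical_exponent_le_one`) and `log n ≤ n`; small `n` are absorbed into `A`.
So a Hölder modulus of continuity for `θ` at `p_c⁺` — the lane's open (T2) — would ALONE put the one-arm rate in the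
polylogarithmic regime, which the effective Kozma–Nitzan scheme cannot reach (R6): (T2) is at least as hard as the polylog
intermediate of (T1).  CONDITIONAL on (T2) (open for `3 ≤ d ≤ 10`); new.
builds on p205010 (kernel theorem, internal audit signed; external expert review pending) (not used).
[cite: DuminilcopinKozmaTassion2020, Theorem 2 (p > p_c)] -/
theorem oneArm_le_rpow_log_of_thetaHolder (hd : 3 ≤ d) {b B : ℝ} (hb : 0 < b) (hθ : ThetaHolderNearCritical d b B) :
    ∃ A : ℝ, ∀ n : ℕ, 2 ≤ n → oneArmProb d (criticalProbI d) n ≤ A * Real.log n ^ (-(b / 2)) := by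
  have hd2 : 2 ≤ d := by omega
  obtain ⟨C, hC, h⟩ := oneArm_criticalProbI_le_theta_sqrt_log hd
  set B' : ℝ := max B 0 with hB'
  have hB'0 : 0 ≤ B' := le_max_right _ _
  have hBB' : B ≤ B' := le_max_left _ _
  have hb1 : b ≤ 1 := thetaHolderNearCritical_exponent_le_one hd2 hθ
  set pc : ℝ := (criticalProbI d : ℝ) with hpcdef
  have hpc1 : pc < 1 := by rw [hpcdef, coe_criticalProbI]; exact criticalProb_zd_lt_one hd2
  set κ : ℝ := (Fintype.card (GM.HOct d) : ℝ) with hκ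
  have hκ0 : 0 ≤ κ := by rw [hκ]; exact Nat.cast_nonneg _
  -- threshold: `√(2C/log n) < 1 - p_c` once `log n > 2C/(1-p_c)²`, i.e. `n ≥ n₁`
  set L : ℝ := 2 * C / (1 - pc) ^ 2 + 1 with hL
  have hL0 : 0 < L := by rw [hL]; positivity
  set n₁ : ℕ := max 2 ⌈Real.exp L⌉₊ with hn₁
  have hn₁2 : 2 ≤ n₁ := le_max_left _ _
  have hsmall : ∀ n : ℕ, n₁ ≤ n → Real.sqrt (2 * C / Real.log n) < 1 - pc := by
    intro n hn
    have hn0 : (0 : ℝ) < n := by exact_mod_cast (show 0 < n by omega)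
    have hlogn : L ≤ Real.log n := by
      have h1 : Real.exp L ≤ n := (Nat.le_ceil _).trans (by exact_mod_cast (le_max_right _ _).trans hn)
      have := Real.log_le_log (Real.exp_pos L) h1
      rwa [Real.log_exp] at this
    have hlogpos : 0 < Real.log n := hL0.trans_le hlogn
    have h2 : 2 * C / Real.log n < (1 - pc) ^ 2 := by
      rw [div_lt_iff₀ hlogpos]
      have : 2 * C / (1 - pc) ^ 2 < Real.log n := by rw [hL] at hlogn; linarith
      rw [div_lt_iff₀ (by positivity)] at this
      linarith
    calc Real.sqrt (2 * C / Real.log n) < Real.sqrt ((1 - pc) ^ 2) := Real.sqrt_lt_sqrt (by positivity) h2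
      _ = 1 - pc := Real.sqrt_sq (by linarith)
  -- the main estimate for `n ≥ n₁`
  set A₁ : ℝ := B' * (2 * C) ^ (b / 2) + 2 * κ with hA₁
  have hmain : ∀ n : ℕ, n₁ ≤ n → oneArmProb d (criticalProbI d) n ≤ A₁ * Real.log n ^ (-(b / 2)) := by
    intro n hn
    have hn2 : 2 ≤ n := hn₁2.trans hn
    have hn0 : (0 : ℝ) < n := by exact_mod_cast (show 0 < n by omega)
    have hn1 : (1 : ℝ) ≤ n := by exact_mod_cast (show 1 ≤ n by omega)
    have hlog : 0 < Real.log n := Real.log_pos (by exact_mod_cast (show 1 < n by omega))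
    have hδlt := hsmall n hn
    set δ : ℝ := Real.sqrt (2 * C / Real.log n) with hδ
    have hδ0 : 0 ≤ δ := Real.sqrt_nonneg _
    have hqI : pc + δ ∈ unitInterval := ⟨by linarith [(criticalProbI d).2.1], by linarith⟩
    set q : unitInterval := ⟨pc + δ, hqI⟩ with hq
    have hqcoe : (q : ℝ) = pc + δ := rfl
    have h1 := h n hn2 q (by rw [hqcoe]) (by rw [hqcoe]; linarith)
    -- `θ(p_c + δ) ≤ B δ^b = B (2C)^{b/2} (log n)^{-b/2}`
    have hth : theta (zdGraph d) 0 q ≤ B' * (2 * C) ^ (b / 2) * Real.log n ^ (-(b / 2)) := by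
      have hpge : criticalProbI d ≤ q := by
        rw [← Subtype.coe_le_coe, hqcoe]; linarith
      have h2 := hθ q hpge
      rw [show (q : ℝ) - criticalProbI d = δ by rw [hqcoe]; ring] at h2
      have h4 : δ ^ b = (2 * C) ^ (b / 2) * Real.log n ^ (-(b / 2)) := by
        rw [hδ, Real.sqrt_eq_rpow, ← Real.rpow_mul (by positivity), Real.div_rpow (by positivity) hlog.le,
          Real.rpow_neg hlog.le, div_eq_mul_inv]
        ring_nf
      calc theta (zdGraph d) 0 q ≤ B * δ ^ b := h2
        _ ≤ B' * δ ^ b := mul_le_mul_of_nonneg_right hBB' (Real.rpow_nonneg hδ0 _)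
        _ = B' * (2 * C) ^ (b / 2) * Real.log n ^ (-(b / 2)) := by rw [h4]; ring
    -- `e^{-√n} ≤ 2/n ≤ 2 (log n)^{-b/2}`
    have hexp : Real.exp (-Real.sqrt n) ≤ 2 * Real.log n ^ (-(b / 2)) := by
      have h2 := exp_neg_sqrt_le_two_div hn0
      have h3 : Real.log n ^ (b / 2) ≤ n := by
        have hl1 : Real.log n ≤ n := (Real.log_le_sub_one_of_pos hn0).trans (by linarith)
        calc Real.log n ^ (b / 2) ≤ (n : ℝ) ^ (b / 2) := Real.rpow_le_rpow hlog.le hl1 (by linarith)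
          _ ≤ (n : ℝ) ^ (1 : ℝ) := Real.rpow_le_rpow_of_exponent_le hn1 (by linarith)
          _ = n := Real.rpow_one _
      have h4 : 2 / (n : ℝ) ≤ 2 * Real.log n ^ (-(b / 2)) := by
        rw [Real.rpow_neg hlog.le, ← div_eq_mul_inv]
        exact div_le_div_of_nonneg_left (by norm_num) (Real.rpow_pos_of_pos hlog _) h3
      exact h2.trans h4
    calc oneArmProb d (criticalProbI d) n
        ≤ theta (zdGraph d) 0 q + κ * Real.exp (-Real.sqrt n) := h1
      _ ≤ B' * (2 * C) ^ (b / 2) * Real.log n ^ (-(b / 2)) + κ * (2 * Real.log n ^ (-(b / 2))) :=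
          add_le_add hth (mul_le_mul_of_nonneg_left hexp hκ0)
      _ = A₁ * Real.log n ^ (-(b / 2)) := by rw [hA₁]; ring
  -- small `n`: `π ≤ 1 ≤ (log n₁)^{b/2} (log n)^{-b/2}` for `2 ≤ n < n₁`
  have hA₁0 : 0 ≤ A₁ := by rw [hA₁]; positivity
  refine ⟨A₁ + Real.log n₁ ^ (b / 2), fun n hn => ?_⟩
  have hn0 : (0 : ℝ) < n := by exact_mod_cast (show 0 < n by omega)
  have hlog : 0 < Real.log n := Real.log_pos (by exact_mod_cast (show 1 < n by omega))
  have hlc0 : 0 ≤ Real.log n ^ (-(b / 2)) := Real.rpow_nonneg hlog.le _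
  have hn₁c : 0 ≤ Real.log n₁ ^ (b / 2) := Real.rpow_nonneg (Real.log_nonneg (by exact_mod_cast (show 1 ≤ n₁ by omega))) _
  by_cases hle : n₁ ≤ n
  · calc oneArmProb d (criticalProbI d) n ≤ A₁ * Real.log n ^ (-(b / 2)) := hmain n hle
      _ ≤ (A₁ + Real.log n₁ ^ (b / 2)) * Real.log n ^ (-(b / 2)) := mul_le_mul_of_nonneg_right (by linarith) hlc0
  · push Not at hle
    have hle' : Real.log n ≤ Real.log n₁ :=
      Real.log_le_log hn0 (by exact_mod_cast hle.le)
    have h1 : 1 ≤ Real.log n₁ ^ (b / 2) * Real.log n ^ (-(b / 2)) := by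
      rw [Real.rpow_neg hlog.le, ← div_eq_mul_inv, le_div_iff₀ (Real.rpow_pos_of_pos hlog _), one_mul]
      exact Real.rpow_le_rpow hlog.le hle' (by linarith)
    calc oneArmProb d (criticalProbI d) n ≤ 1 := by unfold oneArmProb; exact measureReal_le_one
      _ ≤ Real.log n₁ ^ (b / 2) * Real.log n ^ (-(b / 2)) := h1
      _ ≤ (A₁ + Real.log n₁ ^ (b / 2)) * Real.log n ^ (-(b / 2)) := mul_le_mul_of_nonneg_right (by linarith) hlc0

end Summit.CriticalPhenomena.PercolationContinuityZ3.Theorems.Quant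

end
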